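import Summits.BirchSwinnertonDyer.BirchSwinnertonDyer.Theorems.SignedLowerHalvesSprungLowerDivisibilityAtThreeCokerBoundByMass
import Literature.NumberTheory.EllipticCurves.SupersingularSelmerDualTorsionFineSelmer
import HarnessLib

/-!
# Crux `SprungLowerDivisibilityAtThree` (item stmt-BirchSwinnertonDyer-19875; x8 children 22569 / 22901 / 22570 / 23112),
# line `chromatic-common-zeros`: «F-α♮ BY MASS», part 2 — the Wingberg/Matar half (M2) «cotorsion = fine mass at the mirror
# prime» DISCHARGED BY NAME from `matar2020_thm11_selmerDualTorsion_pseudoIso_fineSelmerDual` (p664557) and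
# `Kato2004_fineSelmerDual_isTorsion`; the registered stub F-α♮ from (M1) + two named facts

Cell `bsd-ssimc` (host), width seat `cruxlead-stmt-BirchSwinnertonDyer-19875-w2` (gen 9) under the 19875 LEAD; `--supports`
stmt-BirchSwinnertonDyer-22569 `--as helper`; theorems only; Literature imports + the sibling `…CokerBoundByMass` (p665043);
closes NO item. HONEST FRAMING: CONDITIONAL on the two named facts (Matar 2020 Thm. 1.1 with Thm. 2.2 / Prop. 1.2 (ii); Kato
2004 Thm. 12.4 (1) with (17.13.1)) and on the displayed (M1); nothing about any curve is computed; K_spor, S4b-cyc, K1, leaf X8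
and BSD are NOT proved by anything here.

* §1 `lengthAt_torsion_selmerDual_eq_fine_comap_invol_of_matar` — for `E/ℚ`, `p ≠ 2` good supersingular, the cyclotomic `κ` with
  topological generator `γ`, ANY `S : W.SelmerDualData κ γ` and `Y : W.FineSelmerDualData κ γ` (same key), at every prime `𝔭` of
  height `≤ 1`: `ℓ_𝔭(tors_Λ S.X) = ℓ_{ι𝔭}(Y.X)` — Matar's pseudo-isomorphism `T_Λ(X) ∼ X₀^ι` read at `𝔭` (pseudo-isomorphisms
  preserve local lengths at height `≤ 1`, `Module.lengthAt_eq_of_isPseudoIsomorphism`; the `γ⁻¹`-keyed fine datum is the `ι`-twist,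
  `Kato2004.fineSelmerDualData_exists_involTwist` / `…_lengthAt_inv_eq`; its torsion from the key-`γ` one,
  `Kato2004.isTorsion_of_involSemilinear`). `cotorsion_le_fine_comap_invol_of_matar` = hypothesis (M2) of
  `massIota_of_cotorsion_of_fine` on class X8 (`p = 3` good supersingular).
* §2 `cokerBoundIotaOffT_of_cotorsion_of_matar` — THE REGISTERED STUB SIGNATURE of `IotaDoor.stub_cokerBoundIotaOffT` from (M1)
  «`min(ℓ_𝔭 X♯, ℓ_𝔭 X♭) ≤ ℓ_𝔭 X₀ + ℓ_𝔭 tors_Λ X(E/ℚ_∞)`» (displayed; its algebra is `…CokerBoundByMassSkeleton`, its inputs to type are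
  Poitou–Tate at `H¹_Iw(ℚ_p,T)` and the Selmer conditions at `p` read through Pontryagin duality) and the two named facts.

References: [Matar2020] Thm. 1.1, Thm. 2.2, Prop. 1.2 (ii); [Wingberg1989] Cor. 2.5; [Kato2004Asterisque] Thm. 12.4 (p. 221), (17.13.1)
(p. 279); [Sprung2012] Thm. 7.14 (3) (p. 1504), Prop. 7.19 (p. 1505); [Greenberg1989] §0; tree: `…CokerBoundByMass` (p665043),
`SupersingularSelmerDualTorsionFineSelmer` (p664557), `KatoFineSelmerDualTorsion`, `Kato2004/IwasawaInvolutionTwistProofs`,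
`IwasawaAlgebraCharIdealProofs`.
-/

set_option linter.dupNamespace false
set_option autoImplicit false

noncomputable section

open scoped Classical NumberField MatrixGroups ModularForm

open NumberField IsDedekindDomain CongruenceSubgroup WeierstrassCurve Field
  Literature.NumberTheory.EllipticCurves Literature.NumberTheory.EllipticCurves.ModularForms
  Literature.NumberTheory.EllipticCurves.ZpExtension Literature.NumberTheory.EllipticCurves.Sprung2017
  Literature.NumberTheory.EllipticCurves.Sprung2012 Literature.NumberTheory.EllipticCurves.Rank1Residual
  Literature.NumberTheory.EllipticCurves.IwasawaAlgebra Literature.NumberTheory.EllipticCurves.Kato2004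
  Literature.NumberTheory.EllipticCurves.Module

namespace Summit.BirchSwinnertonDyer.BirchSwinnertonDyer.Theorems.ChromaticCommonZeros

/-! ### §1 (M2) from Matar 2020 Thm. 1.1: `ℓ_𝔭(tors X(E/ℚ_∞)) = ℓ_{ι𝔭}(X₀(E/ℚ_∞))` -/

section Matar

/-- **Wingberg/Matar at one prime.** For `E/ℚ` (globally minimal `W`), `p ≠ 2` of good supersingular reduction, the cyclotomic `κ`
with topological generator `γ`, any `S : W.SelmerDualData κ γ` (`X(E/ℚ_∞)`) and `Y : W.FineSelmerDualData κ γ` (`X₀(E/ℚ_∞)`, SAME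
key), at every prime `𝔭` of height `≤ 1`: `ℓ_𝔭(tors_Λ S.X) = ℓ_{ι𝔭}(Y.X)`. Proof: twist `Y` to a key-`γ⁻¹` datum `Y'` (`Y' = Y^ι`,
torsion with `Y`), apply Matar's pseudo-isomorphism `T_Λ(S.X) ∼ Y'.X`, read lengths (`ℓ_𝔭 Y' = ℓ_{ι𝔭} Y`). CONDITIONAL on the named
facts `matar2020_thm11_selmerDualTorsion_pseudoIso_fineSelmerDual` and `Kato2004_fineSelmerDual_isTorsion`.
[cite: Matar2020, Thm. 1.1, Thm. 2.2, Prop. 1.2 (ii)] [cite: Wingberg1989, Cor. 2.5] [cite: Kato2004Asterisque, Thm. 12.4 (1) (p. 221), (17.13.1) (p. 279)]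
[cite: Greenberg1989, §0 pp. 101–102] -/
theorem lengthAt_torsion_selmerDual_eq_fine_comap_invol_of_matar
    (hMatar : matar2020_thm11_selmerDualTorsion_pseudoIso_fineSelmerDual) (hfine : Kato2004_fineSelmerDual_isTorsion)
    (W : WeierstrassCurve ℚ) [W.IsElliptic] [W.IsGloballyMinimal] (p : ℕ) [Fact p.Prime] (hp : p ≠ 2)
    (hgood : W.HasGoodReductionAtPrime p) (hss : (p : ℤ) ∣ W.frobeniusTrace p)
    {κ : ZpExtension ℚ p} {γ : Field.absoluteGaloisGroup ℚ} (hκ : κ.IsCyclotomic) (hγ : κ.IsTopGenerator γ)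
    (S : W.SelmerDualData κ γ) (Y : W.FineSelmerDualData κ γ) (𝔭 : PrimeSpectrum (IwasawaAlgebra p))
    (h𝔭 : 𝔭.asIdeal.height ≤ 1) :
    Module.lengthAt (IwasawaAlgebra p) (Submodule.torsion (IwasawaAlgebra p) S.X) 𝔭 =
      Module.lengthAt (IwasawaAlgebra p) Y.X (PrimeSpectrum.comap (invol p).toRingHom 𝔭) := by
  obtain ⟨Y', e, he, -⟩ := Kato2004.fineSelmerDualData_exists_involTwist (mul_inv_cancel γ) Y
  have hY't : Module.IsTorsion (IwasawaAlgebra p) Y'.X :=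
    Kato2004.isTorsion_of_involSemilinear (hfine W p κ γ hκ hγ Y) e he
  obtain ⟨φ, hφ⟩ := hMatar W p κ γ γ⁻¹ hp hgood hss hκ hγ (mul_inv_cancel γ) S Y' hY't
  rw [lengthAt_eq_of_isPseudoIsomorphism hφ 𝔭 h𝔭, Kato2004.fineSelmerDualData_lengthAt_inv_eq Y Y' 𝔭]

/-- **(M2) of `massIota_of_cotorsion_of_fine` on class X8, discharged by name** (`p = 3` good supersingular from `ClassX8`;
the inequality `ℓ_𝔭(tors S.X) ≤ ℓ_{ι𝔭}(Y.X)` is Matar's equality). CONDITIONAL on the two named facts.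
[cite: Matar2020, Thm. 1.1] [cite: Wingberg1989, Cor. 2.5] [cite: Kato2004Asterisque, Thm. 12.4 (1) (p. 221)] -/
theorem cotorsion_le_fine_comap_invol_of_matar
    (hMatar : matar2020_thm11_selmerDualTorsion_pseudoIso_fineSelmerDual) (hfine : Kato2004_fineSelmerDual_isTorsion) :
    ∀ (W : WeierstrassCurve ℚ) [W.IsElliptic] [W.IsGloballyMinimal] (p : ℕ) [Fact p.Prime],
      ClassX8 W p → ∀ (κ : ZpExtension ℚ p) (γ : Field.absoluteGaloisGroup ℚ),
      κ.IsCyclotomic → κ.IsTopGenerator γ →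
    ∀ (S : W.SelmerDualData κ γ) (Y : W.FineSelmerDualData κ γ) (𝔭 : PrimeSpectrum (IwasawaAlgebra p)),
      𝔭.asIdeal.height = 1 → (p : IwasawaAlgebra p) ∉ 𝔭.asIdeal →
      Module.lengthAt (IwasawaAlgebra p) (Submodule.torsion (IwasawaAlgebra p) S.X) 𝔭 ≤
        Module.lengthAt (IwasawaAlgebra p) Y.X (PrimeSpectrum.comap (invol p).toRingHom 𝔭) := by
  intro W _ _ p _ hX κ γ hκ hγ S Y 𝔭 h𝔭 _hp𝔭
  obtain ⟨hp3, ⟨hgood, hss⟩, -⟩ := hX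
  subst hp3
  exact (lengthAt_torsion_selmerDual_eq_fine_comap_invol_of_matar hMatar hfine W 3 (by decide) hgood hss hκ hγ S Y 𝔭
    h𝔭.le).le

end Matar

/-! ### §2 The registered stub F-α♮ from (M1) and the two named facts -/

section Stub

/-- **F-α♮ — the registered stub `IotaDoor.stub_cokerBoundIotaOffT` VERBATIM — from (M1) «chromatic excess ≤ cotorsion» and the
named facts of Matar 2020 (Thm. 1.1) and Kato 2004 (Thm. 12.4 (1)).** (M1) = `hM1`: on class X8, in the stub's cyclotomic/Honda
frame, for every `S : W.SelmerDualData κ γ`, dual data `Ds, Df` of `Sel♯, Sel♭`, fine datum `Y`, at every height-one `𝔭 ∌ p, T`: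
`min(ℓ_𝔭 Ds.X, ℓ_𝔭 Df.X) ≤ ℓ_𝔭 Y.X + ℓ_𝔭(tors_Λ S.X)` — in print (SES-KP) (IN TREE) + Poitou–Tate (Kato (17.13.1)) + Kato Thm. 12.4
+ Sprung's Selmer conditions at `p`; its module algebra is `min_lengthAt_le_fine_add_torsion_of_massSkeleton`
(`…CokerBoundByMassSkeleton`), whose instantiation needs ONE typed Poitou–Tate structure on the pinned objects (either keying).
Composition: `cokerBoundIotaOffT_of_massIota ∘ massIota_of_cotorsion_of_fine ∘ cotorsion_le_fine_comap_invol_of_matar`.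
[cite: Kato2004Asterisque, Thm. 12.4 (p. 221), (17.13.1) (p. 279)] [cite: Matar2020, Thm. 1.1] [cite: Wingberg1989, Cor. 2.5]
[cite: Sprung2012, §7.1 Props. 7.3/7.6, Def. 7.9–7.13, Thm. 7.14 (3) (p. 1504)] [cite: KuriharaPollack2007, Prop. 1.2]
[cite: LeiSujatha2021, (SES-KP), (PT)] -/
theorem cokerBoundIotaOffT_of_cotorsion_of_matar
    (hM1 : ∀ (W : WeierstrassCurve ℚ) [W.IsElliptic] [W.IsGloballyMinimal] (p : ℕ) [Fact p.Prime],
      ClassX8 W p → ∀ (κ : ZpExtension ℚ p) (γ : Field.absoluteGaloisGroup ℚ),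
      κ.IsCyclotomic → κ.IsTopGenerator γ →
    ∀ (v : HeightOneSpectrum (𝓞 ℚ)), (p : 𝓞 ℚ) ∈ v.asIdeal →
    ∀ (g : Field.absoluteGaloisGroup (v.adicCompletion ℚ)),
      κ.IsTopGenerator (resGalOfEmb (closureEmb (K := ℚ) (v.adicCompletion ℚ)) g) →
    ∀ (cneg : localPoints W (v.adicCompletion ℚ)) (c : ℕ → localPoints W (v.adicCompletion ℚ)),
      IsHondaSystem κ (closureEmb (K := ℚ) (v.adicCompletion ℚ)) W (W.frobeniusTrace p) g cneg c →
    ∀ (S : W.SelmerDualData κ γ)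
      (Ds : SharpFlatSelmerDualData W κ γ (closureEmb (K := ℚ) (v.adicCompletion ℚ)) (W.frobeniusTrace p) g c
        Chroma.sharp)
      (Df : SharpFlatSelmerDualData W κ γ (closureEmb (K := ℚ) (v.adicCompletion ℚ)) (W.frobeniusTrace p) g c
        Chroma.flat)
      (Y : W.FineSelmerDualData κ γ) (𝔭 : PrimeSpectrum (IwasawaAlgebra p)), 𝔭.asIdeal.height = 1 →
      (p : IwasawaAlgebra p) ∉ 𝔭.asIdeal → (PowerSeries.X : IwasawaAlgebra p) ∉ 𝔭.asIdeal →
      min (Module.lengthAt (IwasawaAlgebra p) Ds.X 𝔭) (Module.lengthAt (IwasawaAlgebra p) Df.X 𝔭) ≤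
        Module.lengthAt (IwasawaAlgebra p) Y.X 𝔭 +
          Module.lengthAt (IwasawaAlgebra p) (Submodule.torsion (IwasawaAlgebra p) S.X) 𝔭)
    (hMatar : matar2020_thm11_selmerDualTorsion_pseudoIso_fineSelmerDual)
    (hfine : Kato2004_fineSelmerDual_isTorsion) :
    ∀ (W : WeierstrassCurve ℚ) [W.IsElliptic] [W.IsGloballyMinimal] (p : ℕ) [Fact p.Prime]
      [ContinuousSMul ℤ_[p] (W.tateModule p)] [Module.Free ℤ_[p] (W.tateModule p)]
      [Module.Finite ℤ_[p] (W.tateModule p)],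
      ClassX8 W p → ∀ (κ : ZpExtension ℚ p) (γ : Field.absoluteGaloisGroup ℚ),
      κ.IsCyclotomic → κ.IsTopGenerator γ → IsCyclotomicVariable p γ →
    ∀ (v : HeightOneSpectrum (𝓞 ℚ)), (p : 𝓞 ℚ) ∈ v.asIdeal →
    ∀ (g : Field.absoluteGaloisGroup (v.adicCompletion ℚ)),
      κ.IsTopGenerator (resGalOfEmb (closureEmb (K := ℚ) (v.adicCompletion ℚ)) g) →
    ∀ (cneg : localPoints W (v.adicCompletion ℚ)) (c : ℕ → localPoints W (v.adicCompletion ℚ)),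
      IsHondaSystem κ (closureEmb (K := ℚ) (v.adicCompletion ℚ)) W (W.frobeniusTrace p) g cneg c →
    ∀ (N : ℕ) (_ : NeZero N) (f : CuspForm (Gamma0 N) 2) (ϖ : ℚ) (Lsharp Lflat : IwasawaAlgebra p),
      IsNewformOf W f → (ϖ : ℝ) * W.realPeriodRat = plusPeriod f →
      IsSprungPair f p (W.frobeniusTrace p) Lsharp Lflat →
    ∀ (I : Kato2004.IwasawaH1Data W p κ γ)
      (Cs : SharpFlatColemanKatoData W p f ϖ κ γ (closureEmb (K := ℚ) (v.adicCompletion ℚ))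
        (W.frobeniusTrace p) g c Chroma.sharp I)
      (Cf : SharpFlatColemanKatoData W p f ϖ κ γ (closureEmb (K := ℚ) (v.adicCompletion ℚ))
        (W.frobeniusTrace p) g c Chroma.flat I),
      Cs.Z = Cf.Z →
    ∀ (Y : W.FineSelmerDualData κ γ) (𝔭 : PrimeSpectrum (IwasawaAlgebra p)), 𝔭.asIdeal.height = 1 →
      (p : IwasawaAlgebra p) ∉ 𝔭.asIdeal → (PowerSeries.X : IwasawaAlgebra p) ∉ 𝔭.asIdeal →
      (∀ (col' : Chroma) (G' : IwasawaAlgebra p),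
        iwasawaToPowerSeries p G' =
          PowerSeries.C (ϖ : ℚ_[p]) * iwasawaToPowerSeries p (chromaticL col' Lsharp Lflat) →
        G' ∈ 𝔭.asIdeal) →
      min (Module.lengthAt (IwasawaAlgebra p) (IwasawaAlgebra p ⧸ LinearMap.range Cs.colMap) 𝔭)
          (Module.lengthAt (IwasawaAlgebra p) (IwasawaAlgebra p ⧸ LinearMap.range Cf.colMap) 𝔭) ≤
        Module.lengthAt (IwasawaAlgebra p) Y.X (PrimeSpectrum.comap (invol p).toRingHom 𝔭) :=
  cokerBoundIotaOffT_of_massIota (massIota_of_cotorsion_of_fine hM1 (cotorsion_le_fine_comap_invol_of_matar hMatar hfine))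
    hfine

end Stub

end Summit.BirchSwinnertonDyer.BirchSwinnertonDyer.Theorems.ChromaticCommonZeros

end
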